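import Summits.Ventures.QEC.Census.BB.A1s_n168_k18_7144a1e2.CoverWitZ1
import Summits.Ventures.QEC.Census.BB.A1s_n168_k18_7144a1e2.CoverWitZ6
import Summits.Ventures.QEC.Census.BB.A1s_n168_k18_7144a1e2.CoverWitZ7
import Summits.Ventures.QEC.Census.BB.A1s_n168_k18_7144a1e2.CoverWitZ8
import Summits.Ventures.QEC.Census.BB.A1s_n168_k18_7144a1e2.Cert
import HarnessLib

/-!
# Census row `A1s_n168_k18_7144a1e2` (`[[168,18,8]]`): the LABEL COVER by translations, witnessed and chunked, tier KERNEL — part 3/4 (chunks 5…7)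
# (qec-search-10 g4: the one-file form p520581 exceeded the gate's 600 s elaboration budget with 11 chunks ⇒ ≤ 3 chunks per file; glued in `CoverZ.lean`)

-/

set_option Elab.async false

namespace Summit.Ventures.QEC.Census.A1s_n168_k18_7144a1e2

open Summit.Ventures.QEC.Census

set_option maxHeartbeats 4000000 in
/-- Labels `[122881, 147457)` are covered (each by its witnessed block / translation; KERNEL, 24576 one-line checks, split depth 6). -/
theorem covZ_5 : coverAutTabWitOK A1s_n168_k18_7144a1e2.coverTabZ 21 59 6 122881 24576 A1s_n168_k18_7144a1e2.witsZ_5 = true := by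
  decide +kernel

set_option maxHeartbeats 4000000 in
/-- Labels `[147457, 172033)` are covered (each by its witnessed block / translation; KERNEL, 24576 one-line checks, split depth 6). -/
theorem covZ_6 : coverAutTabWitOK A1s_n168_k18_7144a1e2.coverTabZ 21 59 6 147457 24576 A1s_n168_k18_7144a1e2.witsZ_6 = true := by
  decide +kernel

set_option maxHeartbeats 4000000 in
/-- Labels `[172033, 196609)` are covered (each by its witnessed block / translation; KERNEL, 24576 one-line checks, split depth 6). -/
theorem covZ_7 : coverAutTabWitOK A1s_n168_k18_7144a1e2.coverTabZ 21 59 6 172033 24576 A1s_n168_k18_7144a1e2.witsZ_7 = true := by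
  decide +kernel

end Summit.Ventures.QEC.Census.A1s_n168_k18_7144a1e2
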